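import Summits.CriticalPhenomena.SAWScalingLimit.Theorems.SAWLoopFugacityFlowIsingBoundaryRatioWindowRectNonInterleave2
import Summits.CriticalPhenomena.SAWScalingLimit.Theorems.SAWLoopFugacityFlowIsingBoundaryRatioWindowRectCellChain
import Summits.CriticalPhenomena.SAWScalingLimit.Theorems.SAWLoopFugacityFlowIsingBoundaryRatioWindowRectRoutesSep
import HarnessLib

/-!
# Interleaved rough darts have linked feet
(line `fk-anchor-transfer`, crux `IsingBoundaryRatio`, stmt-CriticalPhenomena-10650; helper file of the stub
`windowRectPresentation_holds`)

**Theorem** (`false_of_sep_routes`). Let `E` be a connected finite set of edges of the mesh graph of a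
Jordan domain `D` drawn at mesh `δ` (every edge is a segment of `closure D`), `d₀` an external dart with
pairwise distinct boundary darts `d_i = succ^[i] d₀`, `i < N`, and `0 < j < l < m < N`. Suppose the four darts
`d₀, d_l` (pair `A`) and `d_j, d_m` (pair `B`) have FEET `p_i`: points of the closed segments of their missing
edges lying on no edge of `E`, and that the two pairs of feet are joined by paths `A`, `B` running outside
`closure D` except at the feet, at planar distance `> 2δ` from each other (as supplied by
`…WindowRectRoutesSep.exists_sep_routes` for feet on `∂D` whose boundary angles are unlinked with a margin).
Then `False`.

Proof: the closed squares met by `A`, resp. `B`, form two disjoint families (a square meeting both would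
have diameter `> 2δ`), each joined up by steps across sides not in `E` (`…WindowRectCellChain`: the paths
avoid the edges of `E`, which lie in `closure D`, except possibly at the feet, which avoid them by
hypothesis), and containing the exterior squares of their two darts (the foot lies on a side of the exterior
square); this contradicts the non-interleaving theorem `…WindowRectNonInterleave2.nonInterleave`. [folklore]
-/

noncomputable section

open scoped Classical
open Set Metric Complex Literature.Probability.LatticeModels Literature.Probability.LatticeModels.DiscreteRect
  Literature.Probability.LatticeModels.SquareTiling Literature.Probability.RandomPlanarGeometry

namespace Summit.CriticalPhenomena.SAWScalingLimit.Theorems.IsingBoundaryRatio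

namespace WindowRect

variable {δ : ℝ} {E : Finset (Sym2 (Site 2))}

/-- The foot of a dart lies in the closed exterior square of the dart. [folklore] -/
theorem foot_mem_closedSq (hδ : 0 < δ) {x : Site 2} {k : Fin 4} {p : ℂ}
    (hp : p ∈ segment ℝ (meshPoint δ x) (meshPoint δ (x + dir k))) : p ∈ closedSq δ (quad x k) := by
  have h := segment_side_subset_closedSq hδ (quad x k) k
  rw [corner_quad] at h
  exact h hp

/-- A path outside `closure D` except at two feet that avoid the edges of `E` avoids the edges of `E` (drawn in
`closure D`). [folklore] -/
theorem path_avoids_edges {D : JordanDomain}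
    (hEcl : ∀ v w : Site 2, s(v, w) ∈ E → segment ℝ (meshPoint δ v) (meshPoint δ w) ⊆ closure D.carrier)
    {p q : ℂ} (A : Path p q) (hA : ∀ z ∈ range A, z ∉ closure D.carrier ∨ z = p ∨ z = q)
    (hp : ∀ v w : Site 2, s(v, w) ∈ E → p ∉ segment ℝ (meshPoint δ v) (meshPoint δ w))
    (hq : ∀ v w : Site 2, s(v, w) ∈ E → q ∉ segment ℝ (meshPoint δ v) (meshPoint δ w)) :
    ∀ t, ∀ v w : Site 2, s(v, w) ∈ E → A t ∉ segment ℝ (meshPoint δ v) (meshPoint δ w) := by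
  intro t v w hvw hmem
  rcases hA (A t) ⟨t, rfl⟩ with h | h | h
  · exact h (hEcl v w hvw hmem)
  · exact hp v w hvw (h ▸ hmem)
  · exact hq v w hvw (h ▸ hmem)

/-- **Interleaved darts cannot have separated outside routes.** See the module docstring. [folklore] -/
theorem false_of_sep_routes {D : JordanDomain} (hδ : 0 < δ) (hE : ∀ e ∈ E, e ∈ (zdGraph 2).edgeSet)
    (hconn : ∀ x ∈ verts E, ∀ y ∈ verts E, Relation.ReflTransGen (fun a b : Site 2 => s(a, b) ∈ E) x y)
    (hEcl : ∀ v w : Site 2, s(v, w) ∈ E → segment ℝ (meshPoint δ v) (meshPoint δ w) ⊆ closure D.carrier)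
    {d₀ : Site 2 × Fin 4} (hd₀ : IsExtDart E d₀) {N : ℕ}
    (hinj : ∀ i j, i < N → j < N → (succ E)^[i] d₀ = (succ E)^[j] d₀ → i = j)
    {j l m : ℕ} (hj : 0 < j) (hjl : j < l) (hlm : l < m) (hmN : m < N)
    {p₀ pl pj pm : ℂ}
    (hp₀ : p₀ ∈ segment ℝ (meshPoint δ d₀.1) (meshPoint δ (d₀.1 + dir d₀.2)))
    (hpl : pl ∈ segment ℝ (meshPoint δ ((succ E)^[l] d₀).1) (meshPoint δ (((succ E)^[l] d₀).1 + dir ((succ E)^[l] d₀).2)))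
    (hpj : pj ∈ segment ℝ (meshPoint δ ((succ E)^[j] d₀).1) (meshPoint δ (((succ E)^[j] d₀).1 + dir ((succ E)^[j] d₀).2)))
    (hpm : pm ∈ segment ℝ (meshPoint δ ((succ E)^[m] d₀).1) (meshPoint δ (((succ E)^[m] d₀).1 + dir ((succ E)^[m] d₀).2)))
    (hE₀ : ∀ v w : Site 2, s(v, w) ∈ E → p₀ ∉ segment ℝ (meshPoint δ v) (meshPoint δ w))
    (hEl : ∀ v w : Site 2, s(v, w) ∈ E → pl ∉ segment ℝ (meshPoint δ v) (meshPoint δ w))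
    (hEj : ∀ v w : Site 2, s(v, w) ∈ E → pj ∉ segment ℝ (meshPoint δ v) (meshPoint δ w))
    (hEm : ∀ v w : Site 2, s(v, w) ∈ E → pm ∉ segment ℝ (meshPoint δ v) (meshPoint δ w))
    (A : Path p₀ pl) (B : Path pj pm)
    (hA : ∀ z ∈ range A, z ∉ closure D.carrier ∨ z = p₀ ∨ z = pl)
    (hB : ∀ z ∈ range B, z ∉ closure D.carrier ∨ z = pj ∨ z = pm)
    (hdist : ∀ z ∈ range A, ∀ z' ∈ range B, 2 * δ < dist z z') : False := by
  -- the two families of squares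
  set CA : Set (Site 2) := {a | (closedSq δ a ∩ range A).Nonempty} with hCA
  set CB : Set (Site 2) := {a | (closedSq δ a ∩ range B).Nonempty} with hCB
  have hdis : Disjoint CA CB := by
    rw [Set.disjoint_left]
    rintro a ⟨z, hza, hzA⟩ ⟨z', hz'a, hz'B⟩
    exact (not_lt.2 (SquareTiling.dist_le_of_mem_closedSq hza hz'a)) (hdist z hzA z' hz'B)
  have hpA : p₀ ∈ range A := ⟨0, A.source⟩
  have hlA' : pl ∈ range A := ⟨1, A.target⟩
  have hjB' : pj ∈ range B := ⟨0, B.source⟩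
  have hmB' : pm ∈ range B := ⟨1, B.target⟩
  have h0A : quad d₀.1 d₀.2 ∈ CA := ⟨p₀, foot_mem_closedSq hδ hp₀, hpA⟩
  have hlA : quad ((succ E)^[l] d₀).1 ((succ E)^[l] d₀).2 ∈ CA := ⟨pl, foot_mem_closedSq hδ hpl, hlA'⟩
  have hjB : quad ((succ E)^[j] d₀).1 ((succ E)^[j] d₀).2 ∈ CB := ⟨pj, foot_mem_closedSq hδ hpj, hjB'⟩
  have hmB : quad ((succ E)^[m] d₀).1 ((succ E)^[m] d₀).2 ∈ CB := ⟨pm, foot_mem_closedSq hδ hpm, hmB'⟩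
  -- the chains
  have chainA := stepChain_of_path (E := E) hδ A (path_avoids_edges hEcl A hA hE₀ hEl) hlA h0A
  have chainB := stepChain_of_path (E := E) hδ B (path_avoids_edges hEcl B hB hEj hEm) hjB hmB
  exact nonInterleave hE hconn hd₀ hinj hj hjl hlm hmN hdis h0A hlA hjB hmB chainA chainB

end WindowRect

/-- **Interleaved darts cannot have separated outside routes**, closed form (registered sub-goal of
stmt-CriticalPhenomena-10650). [folklore] -/
theorem windowRect_false_of_sep_routes : ∀ {δ : ℝ} {E : Finset (Sym2 (Site 2))} {D : Literature.Probability.RandomPlanarGeometry.JordanDomain}, 0 < δ → (∀ e ∈ E, e ∈ (zdGraph 2).edgeSet) → (∀ x ∈ DiscreteRect.verts E, ∀ y ∈ DiscreteRect.verts E, Relation.ReflTransGen (fun a b : Site 2 => s(a, b) ∈ E) x y) → (∀ v w : Site 2, s(v, w) ∈ E → segment ℝ (meshPoint δ v) (meshPoint δ w) ⊆ closure D.carrier) → ∀ {d₀ : Site 2 × Fin 4}, DiscreteRect.IsExtDart E d₀ → ∀ {N : ℕ}, (∀ i j, i < N → j < N → (DiscreteRect.succ E)^[i] d₀ = (DiscreteRect.succ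 E)^[j] d₀ → i = j) → ∀ {j l m : ℕ}, 0 < j → j < l → l < m → m < N → ∀ {p₀ pl pj pm : ℂ}, p₀ ∈ segment ℝ (meshPoint δ d₀.1) (meshPoint δ (d₀.1 + DiscreteRect.dir d₀.2)) → pl ∈ segment ℝ (meshPoint δ ((DiscreteRect.succ E)^[l] d₀).1) (meshPoint δ (((DiscreteRect.succ E)^[l] d₀).1 + DiscreteRect.dir ((DiscreteRect.succ E)^[l] d₀).2)) → pj ∈ segment ℝ (meshPoint δ ((DiscreteRect.succ E)^[j] d₀).1) (meshPoint δ (((DiscreteRect.succ E)^[j] d₀).1 + DiscreteRect.dir ((DiscreteRect.succ E)^[j] d₀).2)) → pm ∈ segment ℝ (meshPoint δ ((DiscreteRect.succ E)^[m] d₀).1) (meshPoint δ (((DiscreteRect.succ E)^[m] d₀).1 + DiscreteRect.dir ((DiscreteRect.succ E)^[m] d₀).2)) → (∀ v w : Site 2, s(v, w) ∈ E → p₀ ∉ segment ℝ (meshPoint δ v) (meshPoint δ w)) → (∀ v w : Site 2, s(v, w) ∈ E → pl ∉ segment ℝ (meshPoint δ v) (meshPoint δ w)) → (∀ v w : Site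 2, s(v, w) ∈ E → pj ∉ segment ℝ (meshPoint δ v) (meshPoint δ w)) → (∀ v w : Site 2, s(v, w) ∈ E → pm ∉ segment ℝ (meshPoint δ v) (meshPoint δ w)) → ∀ (A : Path p₀ pl) (B : Path pj pm), (∀ z ∈ Set.range A, z ∉ closure D.carrier ∨ z = p₀ ∨ z = pl) → (∀ z ∈ Set.range B, z ∉ closure D.carrier ∨ z = pj ∨ z = pm) → (∀ z ∈ Set.range A, ∀ z' ∈ Set.range B, 2 * δ < dist z z') → False :=
  fun hδ hE hconn hEcl _ hd₀ _ hinj _ _ _ hj hjl hlm hmN _ _ _ _ hp₀ hpl hpj hpm hE₀ hEl hEj hEm A B hA hB hdist =>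
    WindowRect.false_of_sep_routes hδ hE hconn hEcl hd₀ hinj hj hjl hlm hmN hp₀ hpl hpj hpm hE₀ hEl hEj hEm A B hA hB hdist

end Summit.CriticalPhenomena.SAWScalingLimit.Theorems.IsingBoundaryRatio

end
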